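import Summits.KontsevichZagierPeriods.KontsevichZagierPeriods.Statement
import Literature.NumberTheory.Transcendental.KZRelationsLE

/-!
# Birth skeleton — piece `OneAuxiliaryVariable` of the split of `DessinsDimensionOne.ExcursionBudget`

`OneAuxiliaryVariable` (conservativity defect one): `relations ⊓ formalRep_≤d ≤ relations_≤(d+1)` for
every `d`. Line: MERGE then COMPRESS A PAIR.

* `stub_mergeLE` — budgeted merging: every formal combination supported in dimension `≤ d` is congruent
  modulo `relations_≤d` to a difference `[r] − [r']` of two representations of dimension exactly `d`
  (pad lower-dimensional generators up to dimension `d` by Newton–Leibniz cylinders `σ × [0,1]`,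
  compress `ℝ^d` into the unit box by `xᵢ ↦ xᵢ/√(1+xᵢ²)` (rule 2), merge by disjoint translated unions
  (rules 2, 1a), collect signs; in dimension `0` merge by rule 1b). Budgeted form of the tree fact
  `KZ.exists_integralRep_sub`; provable now, size L.
* `stub_pairCompression` — the pair form: two KZ-equivalent representations of the same dimension `d`
  are equivalent inside dimension `≤ d + 1` (= `DimensionBudget.DimOneWithinTwo` in every dimension;
  the open content).
* `OneAuxiliaryVariable_of` — real proof: `c ≡ [r] − [r'] (mod relations_≤d)`, so `[r] − [r'] ∈ relations`,
  compress the pair into `relations_≤(d+1)`, and add back the `relations_≤d`-congruence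
  (`relationsLE_mono`).
-/

namespace Summit.KontsevichZagierPeriods.KontsevichZagierPeriods.Cruxes.ExcursionBudget.OneAuxiliaryVariableLine

open Literature.NumberTheory.Transcendental

/-- Piece 3 of the split (verbatim). -/
def OneAuxiliaryVariable : Prop :=
  ∀ (d : ℕ) (c : Literature.NumberTheory.Transcendental.KZ.FormalRep), c ∈ Literature.NumberTheory.Transcendental.KZ.relations → c ∈ AddSubgroup.closure {x : Literature.NumberTheory.Transcendental.KZ.FormalRep | ∃ (k : ℕ) (s : Literature.NumberTheory.Transcendental.KZ.IntegralRep k), k ≤ d ∧ x = Literature.NumberTheory.Transcendental.KZ.of s} → c ∈ AddSubgroup.closure ((Literature.NumberTheory.Transcendental.KZ.domainAddRel ∪ Literature.NumberTheory.Transcendental.KZ.integrandAddRel ∪ Literature.NumberTheory.Transcendental.KZ.changeOfVariablesRel ∪ Literature.NumberTheory.Transcendental.KZ.newtonLeibnizRel) ∩ (AddSubgroup.closure {x : Literature.NumberTheory.Transcendental.KZ.FormalRep | ∃ (k : ℕ) (s : Literature.NumberTheory.Transcendental.KZ.IntegralRep k), k ≤ d + 1 ∧ x = Literature.NumberTheory.Transcendental.KZ.of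 s} : Set Literature.NumberTheory.Transcendental.KZ.FormalRep))

/-- STUB 1 (budgeted merging, provable now, L): a formal combination supported in dimension `≤ d` is,
modulo the relations truncated at `d`, a difference of two representations of dimension `d`. -/
theorem stub_mergeLE : ∀ (d : ℕ) (c : KZ.FormalRep), c ∈ KZ.formalRepLE d →
    ∃ (r r' : KZ.IntegralRep d), c - (KZ.of r - KZ.of r') ∈ KZ.relationsLE d := by
  sorry

/-- STUB 2 (pair compression, the open content): two KZ-equivalent representations of the same
dimension `d` are equivalent inside dimension `≤ d + 1`. -/
theorem stub_pairCompression : ∀ (d : ℕ) (r r' : KZ.IntegralRep d),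
    KZ.Equivalent r r' → KZ.EquivalentLE (d + 1) r r' := by
  sorry

/-- COMPOSITION (real proof): merging + pair compression give conservativity defect one. -/
theorem OneAuxiliaryVariable_of
    (h1 : ∀ (d : ℕ) (c : KZ.FormalRep), c ∈ KZ.formalRepLE d →
      ∃ (r r' : KZ.IntegralRep d), c - (KZ.of r - KZ.of r') ∈ KZ.relationsLE d)
    (h2 : ∀ (d : ℕ) (r r' : KZ.IntegralRep d), KZ.Equivalent r r' → KZ.EquivalentLE (d + 1) r r') :
    OneAuxiliaryVariable := by
  intro d c hc hcd
  -- the inlined closures are `KZ.formalRepLE d` and `KZ.relationsLE (d + 1)` by `rfl`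
  change c ∈ KZ.formalRepLE d at hcd
  change c ∈ KZ.relationsLE (d + 1)
  obtain ⟨r, r', h⟩ := h1 d c hcd
  have hsub : c - (KZ.of r - KZ.of r') ∈ KZ.relations := KZ.relationsLE_le_relations d h
  have hrr' : KZ.of r - KZ.of r' ∈ KZ.relations := by
    have e : KZ.of r - KZ.of r' = c - (c - (KZ.of r - KZ.of r')) := by abel
    rw [e]
    exact sub_mem hc hsub
  have hpair : KZ.of r - KZ.of r' ∈ KZ.relationsLE (d + 1) := h2 d r r' hrr'
  have e : c = (c - (KZ.of r - KZ.of r')) + (KZ.of r - KZ.of r') := by abel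
  rw [e]
  exact add_mem (KZ.relationsLE_mono (Nat.le_succ d) h) hpair

/-- The skeleton closes the piece from its two stubs. -/
theorem OneAuxiliaryVariable_holds_of_stubs : OneAuxiliaryVariable :=
  OneAuxiliaryVariable_of stub_mergeLE stub_pairCompression

end Summit.KontsevichZagierPeriods.KontsevichZagierPeriods.Cruxes.ExcursionBudget.OneAuxiliaryVariableLine
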